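import Summits.CriticalPhenomena.PercolationContinuityZ3.Theorems.SahiMasterFamilyFInequalityFreeCoordinates

/-!
# The `F`-inequality when two of the three events are comparable: `A ⊆ B` (or `B ⊆ A`, in particular `A = B`) and `G ⊆ A` (or `G ⊆ B`)

Unit `prim-master-conj` (crux anchor stmt-CriticalPhenomena-4575, helper work), gen 22; memo
`run/shared/lean/prim/prim-l12/prim-master-conj/POINTWISE.md` §23.  `F(A,B;G) := (1 + μG)·μ(A∩B∩G) − μG·μ(A∩B) − μ(A∩G)·μ(B∩G)`.
The two comparable configurations not yet in the kernel (prim-bnk-2's `SahiFInduction.F_nonneg_of_inter_subset_third` covers `A ∩ B ⊆ G`):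
* `fIneq_ge_cov_of_first_subset_second`, `fIneq_nonneg_of_first_subset_second` — **`A ⊆ B` ⟹ `F(A,B;G) ≥ Cov(A,G) ≥ 0`** (then `A∩B = A` and
  `μ(B∩G) ≤ μG`, so `F ≥ (1+g)μ(AG) − gμA − gμ(AG) = μ(AG) − gμA`; Harris); `fIneq_nonneg_of_second_subset_first`, **`fIneq_nonneg_of_eq`** (`A = B`,
  gen 20's "Cauchy–Schwarz" case — in fact monotonicity suffices).
* `fIneq_ge_cov_of_third_subset_first`, `fIneq_nonneg_of_third_subset_first` — **`G ⊆ A` ⟹ `F(A,B;G) ≥ Cov(B,G) ≥ 0`** (`A∩G = G`, `A∩B∩G = B∩G`,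
  `μ(A∩B) ≤ μB`); `fIneq_nonneg_of_third_subset_second`.
So `F ≥ 0` is in the kernel whenever two of `A, B, G` are comparable, except for the genuinely open orientation `G ⊇` one of `A, B` only partially
(`A ⊆ G` alone is NOT comparable-trivial; `A ∪ B ⊆ G`, indeed `A ∩ B ⊆ G`, is bnk-2's lemma).  Elementary. [this work]
-/

noncomputable section

open scoped Classical

namespace Summit.CriticalPhenomena.PercolationContinuityZ3.Theorems

open Finset Function
open Literature.Combinatorics.Sahi2008
open Literature.Probability.Percolation.DecisionTree (ind)

namespace Pointwise

variable {ι : Type} [Fintype ι]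

local notation3 (prettyPrint := false) "μ⟦" p ", " X "⟧" => ex (bernoulliWeight p) (ind X)

/-- Monotonicity of the product-weight probability (local copy of the one-liner). [folklore] -/
private theorem mu_le_of_subset (p : ι → unitInterval) {X Y : Set (Set ι)} (h : X ⊆ Y) : μ⟦p, X⟧ ≤ μ⟦p, Y⟧ := by
  have h1 := ex_ind_sub_of_subset (bernoulliWeight p) h
  have h2 := ex_ind_nonneg' p (Y \ X)
  linarith

/-- **`A ⊆ B` ⟹ `F(A,B;G) ≥ Cov(A,G)`.** [this work] -/
theorem fIneq_ge_cov_of_first_subset_second (p : ι → unitInterval) {A B G : Set (Set ι)} (hAB : A ⊆ B) :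
    μ⟦p, A ∩ G⟧ - μ⟦p, A⟧ * μ⟦p, G⟧
      ≤ (1 + μ⟦p, G⟧) * μ⟦p, A ∩ B ∩ G⟧ - μ⟦p, G⟧ * μ⟦p, A ∩ B⟧ - μ⟦p, A ∩ G⟧ * μ⟦p, B ∩ G⟧ := by
  rw [Set.inter_eq_left.2 hAB]
  have h1 : μ⟦p, B ∩ G⟧ ≤ μ⟦p, G⟧ := mu_le_of_subset p Set.inter_subset_right
  have h2 : 0 ≤ μ⟦p, A ∩ G⟧ := ex_ind_nonneg' p _
  nlinarith [mul_le_mul_of_nonneg_left h1 h2]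

/-- **`A ⊆ B` ⟹ `F(A,B;G) ≥ 0`** for increasing `A, G` (Harris for `(A,G)`). [this work] -/
theorem fIneq_nonneg_of_first_subset_second (p : ι → unitInterval) {A B G : Set (Set ι)} (hA : IsUpperSet A) (hG : IsUpperSet G)
    (hAB : A ⊆ B) :
    0 ≤ (1 + μ⟦p, G⟧) * μ⟦p, A ∩ B ∩ G⟧ - μ⟦p, G⟧ * μ⟦p, A ∩ B⟧ - μ⟦p, A ∩ G⟧ * μ⟦p, B ∩ G⟧ := by
  have h := fIneq_ge_cov_of_first_subset_second p (G := G) hAB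
  have hH := cov_ind_nonneg p hA hG
  linarith

/-- **`B ⊆ A` ⟹ `F(A,B;G) ≥ 0`** for increasing `B, G`. [this work] -/
theorem fIneq_nonneg_of_second_subset_first (p : ι → unitInterval) {A B G : Set (Set ι)} (hB : IsUpperSet B) (hG : IsUpperSet G)
    (hBA : B ⊆ A) :
    0 ≤ (1 + μ⟦p, G⟧) * μ⟦p, A ∩ B ∩ G⟧ - μ⟦p, G⟧ * μ⟦p, A ∩ B⟧ - μ⟦p, A ∩ G⟧ * μ⟦p, B ∩ G⟧ := by
  have h := fIneq_nonneg_of_first_subset_second p hB hG (G := G) hBA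
  rw [Set.inter_comm B A] at h
  linarith

/-- **`A = B` ⟹ `F(A,A;G) ≥ 0`** for increasing `A, G` (gen 20's diagonal case; `F(A,A;G) ≥ Cov(A,G)`). [this work] -/
theorem fIneq_nonneg_of_eq (p : ι → unitInterval) {A G : Set (Set ι)} (hA : IsUpperSet A) (hG : IsUpperSet G) :
    0 ≤ (1 + μ⟦p, G⟧) * μ⟦p, A ∩ A ∩ G⟧ - μ⟦p, G⟧ * μ⟦p, A ∩ A⟧ - μ⟦p, A ∩ G⟧ * μ⟦p, A ∩ G⟧ :=
  fIneq_nonneg_of_first_subset_second p hA hG subset_rfl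

/-- **`G ⊆ A` ⟹ `F(A,B;G) ≥ Cov(B,G)`.** [this work] -/
theorem fIneq_ge_cov_of_third_subset_first (p : ι → unitInterval) {A B G : Set (Set ι)} (hGA : G ⊆ A) :
    μ⟦p, B ∩ G⟧ - μ⟦p, B⟧ * μ⟦p, G⟧
      ≤ (1 + μ⟦p, G⟧) * μ⟦p, A ∩ B ∩ G⟧ - μ⟦p, G⟧ * μ⟦p, A ∩ B⟧ - μ⟦p, A ∩ G⟧ * μ⟦p, B ∩ G⟧ := by
  have e1 : A ∩ G = G := Set.inter_eq_right.2 hGA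
  have e2 : A ∩ B ∩ G = B ∩ G := by
    rw [Set.inter_assoc, Set.inter_comm A, Set.inter_assoc, Set.inter_comm G A, e1]
  rw [e1, e2]
  have h1 : μ⟦p, A ∩ B⟧ ≤ μ⟦p, B⟧ := mu_le_of_subset p Set.inter_subset_right
  have h2 : 0 ≤ μ⟦p, G⟧ := ex_ind_nonneg' p _
  nlinarith [mul_le_mul_of_nonneg_left h1 h2]

/-- **`G ⊆ A` ⟹ `F(A,B;G) ≥ 0`** for increasing `B, G`. [this work] -/
theorem fIneq_nonneg_of_third_subset_first (p : ι → unitInterval) {A B G : Set (Set ι)} (hB : IsUpperSet B) (hG : IsUpperSet G)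
    (hGA : G ⊆ A) :
    0 ≤ (1 + μ⟦p, G⟧) * μ⟦p, A ∩ B ∩ G⟧ - μ⟦p, G⟧ * μ⟦p, A ∩ B⟧ - μ⟦p, A ∩ G⟧ * μ⟦p, B ∩ G⟧ := by
  have h := fIneq_ge_cov_of_third_subset_first p (B := B) hGA
  have hH := cov_ind_nonneg p hB hG
  linarith

/-- **`G ⊆ B` ⟹ `F(A,B;G) ≥ 0`** for increasing `A, G`. [this work] -/
theorem fIneq_nonneg_of_third_subset_second (p : ι → unitInterval) {A B G : Set (Set ι)} (hA : IsUpperSet A) (hG : IsUpperSet G)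
    (hGB : G ⊆ B) :
    0 ≤ (1 + μ⟦p, G⟧) * μ⟦p, A ∩ B ∩ G⟧ - μ⟦p, G⟧ * μ⟦p, A ∩ B⟧ - μ⟦p, A ∩ G⟧ * μ⟦p, B ∩ G⟧ := by
  have h := fIneq_nonneg_of_third_subset_first p hA hG (B := A) hGB
  rw [Set.inter_comm B A] at h
  linarith

end Pointwise

end Summit.CriticalPhenomena.PercolationContinuityZ3.Theorems
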